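import Summits.CriticalPhenomena.PercolationContinuityZ3.Theorems.Transplant.SkelFrmBChoiceGeomV
import Summits.CriticalPhenomena.PercolationContinuityZ3.Theorems.Transplant.SkelFrmBChoiceRoomsT
import Summits.CriticalPhenomena.PercolationContinuityZ3.Theorems.Transplant.PlanarCells2LevelsV
import HarnessLib

/-!
# N2 (frames-only node `SamePDropOfSkeletonFrm₁`, OPEN), WAVE 1 under (R-44)/(R-45): THE WORLD ROWS OVER THE V SCHEME `cellGeomSG₂bV` and `QSepGeom` at the fine map —
# the (R-45) `…V` twin of §1/§2 of `SkelFrmBChoiceRoomsT` (stmt-g20/g21)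

(R-45) `…V` TWIN (stmt-g22, 2026-08-23; design owner p3-g17/g18, V port owner hp-8 g42/g43; lead g12 11:31:15Z: the choice function of record moves to
`frmChoiceAllQ3V`): the world rows of `SkelFrmBChoiceRoomsT` §1 over hp-8's V scheme `Skelφ.cellGeomSG₂bV G ψ P w₀ Λ b₀` / face data `faceDataSGV` for a cell structure
`P : PCells2V` (per-axis creep cap + ASYMMETRIC transverse rooms `hB/hF`), statements and proofs VERBATIM with the T ↦ V tokens of record (hp-8 g43's registry
renamedV.txt: `cellGeomSG₂bT ↦ cellGeomSG₂bV`, `faceDataSGT ↦ faceDataSGV`, `profT ↦ profV`, `PCells2T.* ↦ PCells2V.*`); the habitat `Hfull x du` is the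
asymmetric one, still inside `cenS x + Λ_{25·rmax}` (`PCells2V.Hfull_subset_box_image`, PlanarCells2LevelsV).  The CELL-LEVEL column vertex `NegB.colVT` (§2 of the T
file: `colVT`, `colVT_eq`, `colVT_mem_VWin(_schedOfT)`, `colVT_mem_graphBall(_lin)`) is NOT re-declared: the V cells inherit `cenS` and the column slot `offNT` from
`fcellsT … c` by `rfl` (`fcellsV_cenS`, `fcellsV_toPCells2T`), so those T rows serve the V skeletons as they stand (p5-g16's V texts read them by their T names).
* §1 `Skelφ.mem_graphBall_of_mem_Ewv₂bV`, **`mem_graphBall_of_mem_Ewv_Hfull₂bV`** (`hWπ`), **`ψ_mem_box_image_of_mem_Ewv_Hfull₂bV`** (`hWpl`),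
  `ψ_mem_box_image_of_mem_Q₂bV`, `mem_graphBall_of_mem_Q₂bV`, `mem_of_mem_M₂bV`;
* §2 `NegB.qSepGeom_fineA_bV` (`QSepGeom` of `cellGeomSG₂bV` at the fine map of record over the V cells, from hp-8's `qSepGeomSG₂bV`).
NON-VACUITY (lead g11 standing order 03:52:56Z): generic rows (no slot hypotheses).
builds on p205010 (kernel theorem, internal audit signed; external expert review pending) — nothing in this file uses p205010; NOTHING is claimed about the open node
`SamePDropOfSkeletonFrm₁`.
Lane `prim-bschramm`, seat `prim-bschramm-stmt` (gen 22); helper file (`--supports stmt-CriticalPhenomena-4575 --as helper`).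
[cite: KozmaNitzan2024, §4 Lemma 12 (pp. 23–25), p. 26 ((29): columns), p. 31] [cite: MartineauTassion2017, §4.3]
-/


noncomputable section

open scoped Classical

namespace Summit.CriticalPhenomena.PercolationContinuityZ3.Theorems.Transplant

open Literature.Probability.Percolation Literature.Probability.LatticeModels SimpleGraph KNCells
open Literature.Barriers.CriticalPhenomena (graphBall graphBall_mono)
open BoxProdZ2 (ConcRadiiG)

/-! ## §1 The world rows over `cellGeomSG₂bV` (generic; `P : PCells2V`) -/

namespace Skelφ

section World

variable {V : Type} [DecidableEq V] {G : SimpleGraph V} [G.LocallyFinite] {ψ : V → Site 2} {P : PCells2V} {w₀ : V} {Λ : ConcRadiiG} {b₀ : Fin 2 → ℕ}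

/-- **`E_{v,x}` lies in the ball of radius `R`** (scheme `cellGeomSG₂bV`: the incoming between-box window has depth `rB α v δ`, the cube window of `x = v + δ` depth
`rQ α x`). [folklore] -/
theorem mem_graphBall_of_mem_Ewv₂bV {α : ℕ} {v : Site 2} {δ : MDir} {R : ℕ} (hB : Λ.rB α v δ ≤ R) (hQ : Λ.rQ α (v + stepVec δ) ≤ R)
    {x : V} (hx : x ∈ (cellGeomSG₂bV G ψ P w₀ Λ b₀).Ewv α v δ) : x ∈ graphBall G w₀ R := by
  rw [CellGeom.Ewv] at hx
  rcases Finset.mem_union.1 hx with hx | hx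
  · change x ∈ VWin G ψ w₀ (PCells2V.BtwNS P v δ) (Λ.rB α v δ) at hx
    exact graphBall_mono G w₀ hB (mem_graphBall_of_mem_VWin hx)
  · change x ∈ VWin G ψ w₀ (PCells2V.Q P (v + stepVec δ)) (Λ.rQ α (v + stepVec δ)) at hx
    exact graphBall_mono G w₀ hQ (mem_graphBall_of_mem_VWin hx)

/-- **THE WORLD ROW `hWπ`: `E_{v,x} ∪ H_{x,du}` lies in the ball of radius `R`** (scheme `cellGeomSG₂bV`, face data `faceDataSGV`; the staircase profile of `H` is
`ρ a′ x du ·`). [cite: KozmaNitzan2024, §4 p. 31] -/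
theorem mem_graphBall_of_mem_Ewv_Hfull₂bV {α β : ℕ} {v : Site 2} {δ du : MDir} {R : ℕ}
    (hB : Λ.rB α v δ ≤ R) (hQ : Λ.rQ α (v + stepVec δ) ≤ R) (hρ : ∀ ℓ, Λ.ρ β (v + stepVec δ) du ℓ ≤ R)
    {x : V} (hx : x ∈ (cellGeomSG₂bV G ψ P w₀ Λ b₀).Ewv α v δ ∪ (faceDataSGV G ψ P w₀ Λ).Hfull β (v + stepVec δ) du) : x ∈ graphBall G w₀ R := by
  rcases Finset.mem_union.1 hx with hx | hx
  · exact mem_graphBall_of_mem_Ewv₂bV hB hQ hx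
  · change x ∈ VStair G ψ w₀ (PCells2V.Hfull P (v + stepVec δ) du) (profV P Λ β (v + stepVec δ) du) at hx
    exact graphBall_mono G w₀ (hρ _) (mem_of_mem_VStair hx).2

/-- **THE WORLD ROW `hWpl`: planar footprints of `E_{v,x} ∪ H_{x,du}` lie in `cenS x + Λ_{25·rmax}`** (`x = v + δ`; the narrow arm `BtwNS v δ`, the cube `Q x` and the
habitat `Hfull x du` are all within 25 units of the target's STAGGERED centre). [cite: KozmaNitzan2024, §4 Lemma 12 (p. 24)] -/
theorem ψ_mem_box_image_of_mem_Ewv_Hfull₂bV {α β : ℕ} {v : Site 2} {δ du : MDir}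
    {x : V} (hx : x ∈ (cellGeomSG₂bV G ψ P w₀ Λ b₀).Ewv α v δ ∪ (faceDataSGV G ψ P w₀ Λ).Hfull β (v + stepVec δ) du) :
    ψ x ∈ (box 2 (25 * P.rmax)).image (fun s => s + P.cenS (v + stepVec δ)) := by
  have hQimg : PCells2V.Q P (v + stepVec δ) ⊆ (box 2 (25 * P.rmax)).image (fun s => s + P.cenS (v + stepVec δ)) :=
    (P.Q_subset_box_image _).trans (Finset.image_subset_image (box_mono 2 (by omega)))
  rcases Finset.mem_union.1 hx with hx | hx
  · rw [CellGeom.Ewv] at hx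
    rcases Finset.mem_union.1 hx with hx | hx
    · change x ∈ VWin G ψ w₀ (PCells2V.BtwNS P v δ) (Λ.rB α v δ) at hx
      exact P.BtwNS_subset_box_image_tgt v δ (φ_mem_of_mem_VWin hx)
    · change x ∈ VWin G ψ w₀ (PCells2V.Q P (v + stepVec δ)) (Λ.rQ α (v + stepVec δ)) at hx
      exact hQimg (φ_mem_of_mem_VWin hx)
  · change x ∈ VStair G ψ w₀ (PCells2V.Hfull P (v + stepVec δ) du) (profV P Λ β (v + stepVec δ) du) at hx
    exact P.Hfull_subset_box_image _ _ (mem_of_mem_VStair hx).1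

/-- The planar footprint of a cube vertex lies in `cenS y + Λ_{5·rmax}`. [folklore] -/
theorem ψ_mem_box_image_of_mem_Q₂bV {a : ℕ} {y : Site 2} {x : V} (hx : x ∈ (cellGeomSG₂bV G ψ P w₀ Λ b₀).Q a y) :
    ψ x ∈ (box 2 (5 * P.rmax)).image (fun s => s + P.cenS y) := by
  change x ∈ VWin G ψ w₀ (PCells2V.Q P y) (Λ.rQ a y) at hx
  exact P.Q_subset_box_image _ (φ_mem_of_mem_VWin hx)

/-- A cube vertex lies in the ball of the cube's radius. [folklore] -/
theorem mem_graphBall_of_mem_Q₂bV {a : ℕ} {y : Site 2} {x : V} (hx : x ∈ (cellGeomSG₂bV G ψ P w₀ Λ b₀).Q a y) : x ∈ graphBall G w₀ (Λ.rQ a y) := by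
  change x ∈ VWin G ψ w₀ (PCells2V.Q P y) (Λ.rQ a y) at hx
  exact mem_graphBall_of_mem_VWin hx

/-- An arrival-box vertex lies in the ball of radius `rM` and maps into the small box `Mb b₀ y`. [folklore] -/
theorem mem_of_mem_M₂bV {a : ℕ} {y : Site 2} {x : V} (hx : x ∈ (cellGeomSG₂bV G ψ P w₀ Λ b₀).M a y) :
    ψ x ∈ PCells2V.Mb P b₀ y ∧ x ∈ graphBall G w₀ (Λ.rM a y) := by
  rw [cellGeomSG₂bV_M] at hx
  exact ⟨φ_mem_of_mem_VWin hx, mem_graphBall_of_mem_VWin hx⟩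

end World

end Skelφ

/-! ## §2 `QSepGeom` at the fine map of record over the V cells -/

namespace PlanarSkeletonFrm

namespace NegB

open SkelConc (Consts)
open Neg

section Col

variable (κ : Consts) {V : Type} [DecidableEq V] [Countable V] {G : SimpleGraph V} [G.LocallyFinite] (Φ : PlanarSkeletonFrm G) (t : V)
  (p : unitInterval) (D : Skelφ.StepI.DataNS V) (g f : ℕ) (c hf : Fin 2 → ℕ) {φ' : V → Site 2}

/-- **`QSepGeom` for the V cells at the fine map of record** (any schedule, any boxes): the (C) residue's `hQ` at `NegB.ΓQV` (with `φ′ := φL …`, `D := O.merged`,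
`hN := eqNumL_of_atQV hAt`). [cite: KozmaNitzan2024, §4 p. 26 ((29))] -/
theorem qSepGeom_fineA_bV (hlip : Skelφ.Lip G φ') (hN : EqNumL κ Φ t p D g f) (Λ : ConcRadiiG) (b₀ : Fin 2 → ℕ) :
    QSepGeom G (Skelφ.cellGeomSG₂bV G (fineA κ Φ t p D g f φ') (fcellsV κ Φ t p D g f c hf) t Λ b₀) :=
  Skelφ.qSepGeomSG₂bV _ _ _ (lip_fineA_at κ Φ t p D g f hlip hN)

end Col

end NegB

end PlanarSkeletonFrm

end Summit.CriticalPhenomena.PercolationContinuityZ3.Theorems.Transplant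

end
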